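import Mathlib
import Summits.MatrixMultiplication.MatrixMultiplication.Theorems.LevelGradedCohnUmansLevelOneGL2DesignsStubTangencySetsHermitianRankThree
import Summits.MatrixMultiplication.MatrixMultiplication.Theorems.LevelGradedCohnUmansLevelOneGL2DesignsTangencyUpperBound
import Summits.MatrixMultiplication.MatrixMultiplication.Theorems.LevelGradedCohnUmansLevelOneGL2DesignsQuadraticLiftExponent

/-!
# Stub `stub_tangencySets` (crux `LevelOneGL2Designs`, stmt-MatrixMultiplication-14080) —
wall-breaker axis 1/12 "Hermitian unital constructions" (gen 1, seat 2), part C′: the known window of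
the rank-three normal form

Part C (`…HermitianRankThree.lean`) put the wall in the form "largest `n` with an `n × n` matrix over
`ZMod p` of rank `≤ 3`, zero diagonal, nowhere-zero off-diagonal" (`= IM(2,p) + O(1)`).  This file
transports the tree's two best bounds for tangency sets to that form, so that the matrix problem is
stated with its current window and no geometry:

* `rankThree_card_le` — `n ≤ p^{3/2} + p + 2` for every prime (eigenvalue / ISW bound,
  `TangencyRandAlg.srs_card_le_rpow`, via `srs_of_rank_le_three`);
* `exists_rankThree_card_ge` — `n ≥ c·p^{5/4}` for every prime, `c > 0` absolute (the quadratic-order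
  digit lift `QuadraticLift.exists_srs_card_ge_rpow_five_fourths`, via `srs_defect_rank_le_three`);
  cofinally `n ≥ p^{3/2−ε}` is Pohoata 2026 (paper).

The stub asks to close the window at the top: `n ≥ c·p^{3/2}` for unboundedly many primes
(`stub_tangencySets_iff_rankThree`).  No new definitions.
-/

set_option linter.dupNamespace false

namespace Summit.MatrixMultiplication.MatrixMultiplication.Theorems.LevelOneGL2Designs.HermitianUnital

open Finset Matrix

/-- **Upper edge of the window.**  A square matrix over `ZMod p` (`p` prime) with zero diagonal,
nowhere-zero off-diagonal and rank `≤ 3` has at most `p^{3/2} + p + 2` rows.  [tree: eigenvalue bound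
`srs_card_le_rpow` + `srs_of_rank_le_three`] -/
theorem rankThree_card_le (p : ℕ) [Fact p.Prime] {ι : Type*} [Fintype ι] [DecidableEq ι]
    (E : Matrix ι ι (ZMod p)) (h0 : ∀ i, E i i = 0) (h1 : ∀ i j, i ≠ j → E i j ≠ 0)
    (hE : E.rank ≤ 3) :
    (Fintype.card ι : ℝ) ≤ (p : ℝ) ^ (3 / 2 : ℝ) + p + 2 := by
  classical
  obtain ⟨S, hcard, hS⟩ := srs_of_rank_le_three E h0 h1 hE
  have hup := TangencyRandAlg.srs_card_le_rpow S hS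
  have hcard' : (Fintype.card ι : ℝ) ≤ S.card + 2 := by exact_mod_cast hcard
  linarith

/-- **Lower edge of the window (every prime).**  For some absolute `c > 0` and every prime `p` there is
a square matrix over `ZMod p` with at least `c·p^{5/4}` rows, zero diagonal, nowhere-zero off-diagonal
and rank `≤ 3` (the defect matrix of the quadratic-order digit lift).  [tree:
`QuadraticLift.exists_srs_card_ge_rpow_five_fourths` + `srs_defect_rank_le_three`] -/
theorem exists_rankThree_card_ge :
    ∃ c : ℝ, 0 < c ∧ ∀ p : ℕ, p.Prime →
      ∃ (n : ℕ) (E : Matrix (Fin n) (Fin n) (ZMod p)),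
        c * (p : ℝ) ^ (5 / 4 : ℝ) ≤ n ∧ (∀ i, E i i = 0) ∧ (∀ i j, i ≠ j → E i j ≠ 0) ∧
        E.rank ≤ 3 := by
  classical
  obtain ⟨c, hc, h⟩ := QuadraticLift.exists_srs_card_ge_rpow_five_fourths
  refine ⟨c, hc, fun p hp => ?_⟩
  haveI : Fact p.Prime := ⟨hp⟩
  obtain ⟨S, hbig, hS⟩ := h p hp
  obtain ⟨h0, h1, hr⟩ := srs_defect_rank_le_three S hS
  let e : Fin S.card ≃ S := (S.equivFin).symm
  refine ⟨S.card, Matrix.of fun i j => (e i).1.1 ⬝ᵥ (e j).1.2 - 1, by simpa using hbig,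
    fun i => h0 (e i), fun i j hij => h1 (e i) (e j) (fun h' => hij (e.injective h')), ?_⟩
  have : (Matrix.of fun i j : Fin S.card => (e i).1.1 ⬝ᵥ (e j).1.2 - 1) =
      (Matrix.of fun f f' : S => f.1.1 ⬝ᵥ f'.1.2 - 1).submatrix e e := by
    ext i j; rfl
  rw [this, rank_submatrix _ e e]
  exact hr

end Summit.MatrixMultiplication.MatrixMultiplication.Theorems.LevelOneGL2Designs.HermitianUnital
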